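import Summits.AnomalousDissipation.AnomalousDissipation.Theorems.SolenoidalFractalHomogenisationLagrangianStepCellCorrectorContent
import Literature.Analysis.FunctionSpaces.TorusGridCharacters
import HarnessLib

/-!
# K1L tensor cell package — the grid-character projection onto the sectors of a small symmetric block

Helper file for the crux `LagrangianRenormalisationStep` (route `SolenoidalFractalHomogenisation`, item
`stmt-AnomalousDissipation-24912`, line «onelevel», stub `stub_cellEnergyT`, clause (F_T)).  Along the `1/n`-periodic cell carrier the
Bloch sectors `±ℓ₀ + nℤ³` decouple.  For a finite symmetric block `S` of SMALL frequencies (`2|ℓ₀ᵢ| < n`) the real linear combination of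
grid translates
`P v (x) = Σ_{j ∈ (ℤ/n)³} c_j · v(x + j/n)`, `c_j = n^{-3} Σ_{ℓ₀ ∈ S} cos(2π ℓ₀·j/n)`,
is the Fourier projection onto the union `B = ⋃_{ℓ₀∈S} (ℓ₀ + nℤ³)` of the residue classes of `S`: its multiplier
`Σ_j c_j e_k(j/n)` equals the number of `ℓ₀ ∈ S` congruent to `k` mod `n`, which is `0` or `1`, and `1` on `S`
(`gridMultiplier_eq`, `card_filter_dvd_sub_le_one`, `card_filter_dvd_sub_eq_one_of_mem`).  Consequently `P` commutes with the cell
problem (`IsWeakTensorPassiveVectorOn.sum_smul_translate'`), preserves weak divergence-freeness and `L²`, and does not increase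
the energy (`integral_norm_sq_sum_smul_translate_le`).

## References

* H. L. Montgomery, R. C. Vaughan, *Multiplicative Number Theory I* (CUP 2007), §4.1 (4.1) (orthogonality of additive characters). [`MontgomeryVaughan2007`]
* L. Grafakos, *Classical Fourier Analysis* (3rd ed., 2014), Prop. 3.2.2 (6) (translation ↔ modulation). [`Grafakos2014`]
-/

set_option linter.dupNamespace false

noncomputable section

namespace Summit.AnomalousDissipation.AnomalousDissipation.Theorems.SolenoidalFractalHomogenisation.LagrangianStep

open Literature.Analysis Literature.Analysis.FluidPDE Literature.Analysis.FunctionSpaces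
open MeasureTheory Set Filter Function UnitAddTorus
open scoped ENNReal NNReal InnerProductSpace

/-! ## §1 Residue classes of a small symmetric block are simple -/

/-- Two integer frequencies with all coordinates `< n/2` in absolute value that are congruent mod `n` coincide. [folklore] -/
theorem eq_of_small_of_dvd_sub {n : ℕ} {a b : Fin 3 → ℤ} (ha : ∀ i, 2 * |a i| < n) (hb : ∀ i, 2 * |b i| < n)
    (h : ∀ i, (n:ℤ) ∣ a i - b i) : a = b := by
  funext i
  have h1 : |a i - b i| < n := by
    have := abs_sub (a i) (b i)
    have ha' := ha i
    have hb' := hb i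
    linarith
  have h2 := Int.eq_zero_of_abs_lt_dvd (h i) h1
  linarith

open Classical in
/-- At most one element of a small block is congruent to a given frequency. [folklore] -/
theorem card_filter_dvd_sub_le_one {n : ℕ} (S : Finset (Fin 3 → ℤ)) (hSsmall : ∀ ℓ₀ ∈ S, ∀ i, 2 * |ℓ₀ i| < n)
    (k : Fin 3 → ℤ) : (S.filter fun ℓ₀ => ∀ i, (n:ℤ) ∣ k i - ℓ₀ i).card ≤ 1 := by
  refine Finset.card_le_one.2 fun a ha b hb => ?_
  obtain ⟨haS, hak⟩ := Finset.mem_filter.1 ha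
  obtain ⟨hbS, hbk⟩ := Finset.mem_filter.1 hb
  refine eq_of_small_of_dvd_sub (hSsmall a haS) (hSsmall b hbS) fun i => ?_
  have := dvd_sub (hbk i) (hak i)
  rwa [sub_sub_sub_cancel_left] at this

open Classical in
/-- At most one element of a small block is congruent to MINUS a given frequency. [folklore] -/
theorem card_filter_dvd_add_le_one {n : ℕ} (S : Finset (Fin 3 → ℤ)) (hSsmall : ∀ ℓ₀ ∈ S, ∀ i, 2 * |ℓ₀ i| < n)
    (k : Fin 3 → ℤ) : (S.filter fun ℓ₀ => ∀ i, (n:ℤ) ∣ k i + ℓ₀ i).card ≤ 1 := by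
  refine Finset.card_le_one.2 fun a ha b hb => ?_
  obtain ⟨haS, hak⟩ := Finset.mem_filter.1 ha
  obtain ⟨hbS, hbk⟩ := Finset.mem_filter.1 hb
  refine eq_of_small_of_dvd_sub (hSsmall a haS) (hSsmall b hbS) fun i => ?_
  have := dvd_sub (hak i) (hbk i)
  rwa [add_sub_add_left_eq_sub] at this

open Classical in
/-- For a symmetric block the two congruence counts agree (`ℓ₀ ↦ −ℓ₀`). [folklore] -/
theorem card_filter_dvd_add_eq {n : ℕ} (S : Finset (Fin 3 → ℤ)) (hS : ∀ k ∈ S, -k ∈ S) (k : Fin 3 → ℤ) :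
    (S.filter fun ℓ₀ => ∀ i, (n:ℤ) ∣ k i + ℓ₀ i).card = (S.filter fun ℓ₀ => ∀ i, (n:ℤ) ∣ k i - ℓ₀ i).card := by
  refine Finset.card_bij (fun a _ => -a) (fun a ha => ?_) (fun a₁ _ a₂ _ h => neg_injective h) (fun b hb => ?_)
  · obtain ⟨haS, hak⟩ := Finset.mem_filter.1 ha
    exact Finset.mem_filter.2 ⟨hS a haS, fun i => by simpa [sub_neg_eq_add] using hak i⟩
  · obtain ⟨hbS, hbk⟩ := Finset.mem_filter.1 hb
    refine ⟨-b, Finset.mem_filter.2 ⟨hS b hbS, fun i => ?_⟩, neg_neg b⟩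
    simpa [← sub_eq_add_neg] using hbk i

open Classical in
/-- A block element is congruent to itself: the count is `1` on the block. [folklore] -/
theorem card_filter_dvd_sub_eq_one_of_mem {n : ℕ} (S : Finset (Fin 3 → ℤ)) (hSsmall : ∀ ℓ₀ ∈ S, ∀ i, 2 * |ℓ₀ i| < n)
    {k : Fin 3 → ℤ} (hk : k ∈ S) : (S.filter fun ℓ₀ => ∀ i, (n:ℤ) ∣ k i - ℓ₀ i).card = 1 :=
  le_antisymm (card_filter_dvd_sub_le_one S hSsmall k)
    (Finset.card_pos.2 ⟨k, Finset.mem_filter.2 ⟨hk, fun i => by simp⟩⟩)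

open Classical in
/-- A nonzero count exhibits a block element congruent to the frequency. [folklore] -/
theorem exists_of_card_filter_dvd_sub_ne_zero {n : ℕ} (S : Finset (Fin 3 → ℤ)) {k : Fin 3 → ℤ}
    (h : (S.filter fun ℓ₀ => ∀ i, (n:ℤ) ∣ k i - ℓ₀ i).card ≠ 0) : ∃ ℓ₀ ∈ S, ∀ i, (n:ℤ) ∣ k i - ℓ₀ i := by
  obtain ⟨ℓ₀, hℓ₀⟩ := Finset.card_pos.1 (Nat.pos_of_ne_zero h)
  exact ⟨ℓ₀, (Finset.mem_filter.1 hℓ₀).1, (Finset.mem_filter.1 hℓ₀).2⟩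

/-! ## §2 The multiplier of the grid-character projection -/

open Classical in
/-- **The grid-character multiplier counts congruent block elements.**  For `n ≥ 1`, a symmetric block `S` and every frequency `k`:
`Σ_{j∈(ℤ/n)³} (n⁻³ Σ_{ℓ₀∈S} cos(2π ℓ₀·j/n)) e_k(j/n) = #{ℓ₀ ∈ S : ℓ₀ ≡ k (mod n)}` (orthogonality of the additive characters of
`(ℤ/n)³`). [cite: MontgomeryVaughan2007, §4.1 (4.1)] -/
theorem gridMultiplier_eq {n : ℕ} (hn : 0 < n) (S : Finset (Fin 3 → ℤ)) (hS : ∀ k ∈ S, -k ∈ S) (k : Fin 3 → ℤ) :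
    (∑ j : Fin 3 → Fin n, (((1 / (n:ℝ) ^ 3 * ∑ ℓ₀ ∈ S, Real.cos (2 * Real.pi * (∑ i, (ℓ₀ i : ℝ) * ((j i : ℕ) : ℝ)) / n)) : ℝ) : ℂ) *
        UnitAddTorus.mFourier k (fun i => ((((j i : ℕ) : ℝ) / n : ℝ) : UnitAddCircle))) =
      ((S.filter fun ℓ₀ => ∀ i, (n:ℤ) ∣ k i - ℓ₀ i).card : ℂ) := by
  have hn0 : (n:ℂ) ≠ 0 := by exact_mod_cast hn.ne'
  have hK : ((1 / (n:ℝ) ^ 3 : ℝ) : ℂ) = 1 / (n:ℂ) ^ 3 := by push_cast; ring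
  -- summand: constant × Σ_{ℓ₀} cos × character
  have hsummand : ∀ j : Fin 3 → Fin n,
      (((1 / (n:ℝ) ^ 3 * ∑ ℓ₀ ∈ S, Real.cos (2 * Real.pi * (∑ i, (ℓ₀ i : ℝ) * ((j i : ℕ) : ℝ)) / n)) : ℝ) : ℂ) *
          UnitAddTorus.mFourier k (fun i => ((((j i : ℕ) : ℝ) / n : ℝ) : UnitAddCircle)) =
        (1 / (n:ℂ) ^ 3) * ∑ ℓ₀ ∈ S, ((Real.cos (2 * Real.pi * (∑ i, (ℓ₀ i : ℝ) * ((j i : ℕ) : ℝ)) / n) : ℝ) : ℂ) *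
          UnitAddTorus.mFourier k (fun i => ((((j i : ℕ) : ℝ) / n : ℝ) : UnitAddCircle)) := by
    intro j
    rw [Complex.ofReal_mul, Complex.ofReal_sum, hK, mul_assoc, Finset.sum_mul]
  rw [Finset.sum_congr rfl fun j _ => hsummand j, ← Finset.mul_sum, Finset.sum_comm]
  -- inner sums by orthogonality
  have hinner : ∀ ℓ₀ ∈ S, ∑ j : Fin 3 → Fin n, ((Real.cos (2 * Real.pi * (∑ i, (ℓ₀ i : ℝ) * ((j i : ℕ) : ℝ)) / n) : ℝ) : ℂ) *
        UnitAddTorus.mFourier k (fun i => ((((j i : ℕ) : ℝ) / n : ℝ) : UnitAddCircle)) =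
      ((if ∀ i, (n : ℤ) ∣ k i + ℓ₀ i then ((n : ℂ) ^ 3) else 0) +
        (if ∀ i, (n : ℤ) ∣ k i - ℓ₀ i then ((n : ℂ) ^ 3) else 0)) / 2 := by
    intro ℓ₀ _
    have h := FunctionSpaces.Torus.sum_cos_mul_mFourier_grid hn ℓ₀ k
    simpa only [Fintype.card_fin] using h
  rw [Finset.sum_congr rfl hinner]
  -- evaluate
  have hterm : ∀ ℓ₀ ∈ S, (1 / (n:ℂ) ^ 3) * (((if ∀ i, (n : ℤ) ∣ k i + ℓ₀ i then ((n : ℂ) ^ 3) else 0) +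
        (if ∀ i, (n : ℤ) ∣ k i - ℓ₀ i then ((n : ℂ) ^ 3) else 0)) / 2) =
      ((if ∀ i, (n : ℤ) ∣ k i + ℓ₀ i then (1:ℂ) else 0) + (if ∀ i, (n : ℤ) ∣ k i - ℓ₀ i then (1:ℂ) else 0)) / 2 := by
    intro ℓ₀ _
    have hn3 : (n:ℂ) ^ 3 ≠ 0 := pow_ne_zero _ hn0
    split_ifs <;> field_simp <;> ring
  rw [Finset.mul_sum, Finset.sum_congr rfl hterm, ← Finset.sum_div, Finset.sum_add_distrib, Finset.sum_boole, Finset.sum_boole,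
    card_filter_dvd_add_eq S hS k]
  ring

/-! ## §3 The projected field: divergence, `L²`, energy -/

/-- Real linear combinations of translates of a weakly divergence-free integrable field are weakly divergence free. [folklore] -/
theorem isWeaklyDivFree_sum_smul_translate {ι : Type*} [Fintype ι] (g : ι → UnitAddTorus (Fin 3)) (c : ι → ℝ) {v : VF}
    (hv : FunctionSpaces.Torus.IsWeaklyDivFree v) (hvi : Integrable v volume) :
    FunctionSpaces.Torus.IsWeaklyDivFree (fun x => ∑ i, c i • v (x + g i)) := by
  intro θ hθ
  have hint : ∀ i ∈ (Finset.univ : Finset ι), Integrable (fun x => ⟪c i • v (x + g i), FunctionSpaces.Torus.gradient θ x⟫_ℝ) volume := by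
    intro i _
    have h1 : Integrable (fun x => c i • v (x + g i)) volume := by
      simpa only [Pi.smul_def] using (hvi.comp_add_right (g i)).smul (c i)
    exact FunctionSpaces.Torus.integrable_inner_of_continuous h1 hθ.gradient.continuous
  simp_rw [sum_inner]
  rw [integral_finsetSum _ hint]
  refine Finset.sum_eq_zero fun i _ => ?_
  simp_rw [real_inner_smul_left]
  rw [integral_const_mul, (hv.translate (g i)) θ hθ, mul_zero]

/-- Real linear combinations of translates of an `L²` field are `L²`. [folklore] -/
theorem memLp_two_sum_smul_translate {ι : Type*} [Fintype ι] (g : ι → UnitAddTorus (Fin 3)) (c : ι → ℝ) {v : VF}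
    (hv : MemLp v 2 volume) : MemLp (fun x => ∑ i, c i • v (x + g i)) 2 volume := by
  refine memLp_finsetSum _ fun i _ => ?_
  have h1 : MemLp (fun x => v (x + g i)) 2 volume :=
    hv.comp_measurePreserving (measurePreserving_add_right volume (g i))
  exact h1.const_smul (c i)

/-- **A grid-character combination with multiplier of modulus `≤ 1` does not increase the energy** (Parseval).
[cite: Grafakos2014, Prop. 3.2.2 (6)] -/
theorem integral_norm_sq_sum_smul_translate_le {ι : Type*} [Fintype ι] (g : ι → UnitAddTorus (Fin 3)) (c : ι → ℝ) {v : VF}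
    (hv : MemLp v 2 volume) (hm : ∀ k, ‖∑ i, (c i : ℂ) * UnitAddTorus.mFourier k (g i)‖ ≤ 1) :
    ∫ x, ‖∑ i, c i • v (x + g i)‖ ^ 2 ≤ ∫ x, ‖v x‖ ^ 2 := by
  have hP := memLp_two_sum_smul_translate g c hv
  have h1 := FunctionSpaces.Torus.hasSum_sq_norm_mFourierCoeff_complexify hP
  have h2 := FunctionSpaces.Torus.hasSum_sq_norm_mFourierCoeff_complexify hv
  refine hasSum_le (fun k => ?_) h1 h2
  rw [Torus.mFourierCoeff_complexify_sum_smul_translate' g c (hv.integrable one_le_two) k, norm_smul, mul_pow]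
  have h3 : ‖∑ i, (c i : ℂ) * UnitAddTorus.mFourier k (g i)‖ ^ 2 ≤ 1 := pow_le_one₀ (norm_nonneg _) (hm k)
  have h4 := sq_nonneg ‖mFourierCoeff (FunctionSpaces.EuclideanSpace.complexify ∘ v) k‖
  nlinarith

end Summit.AnomalousDissipation.AnomalousDissipation.Theorems.SolenoidalFractalHomogenisation.LagrangianStep

end
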